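import Summits.Ventures.DiscreteObjects.Hadamard.ConferenceGraph333TwoCells
import Summits.Ventures.DiscreteObjects.Hadamard.ClassSumTrace

/-!
# Automorphisms of prime order `p ≡ 3 (mod 4)` of srg(333,166,82,83) fix `f ≡ 333 (mod 2p)` vertices (kernel)

Framing: lottery ticket; floor = certified bounds/negative ranges.  Cell pub-namedobj (venture DiscreteObjects),
target (H) = `H(668)`, hadamard gen 28.  UNIFORM PRIME-ORDER CENSUS LINE for `srg(333,166,82,83)` ⇔ symmetric
`C(334)` (⇒ `H(668)`): companions `ConferenceGraph333Order3` (the case `p = 3`, with explicit three-element orbits)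
and `ConferenceGraph333Involution` (`p = 2`: `f ≡ 1 (mod 4)`).  Method: orbit matrices (Behbahani–Lam 2011) + the
trace condition `tr R = 0` of `ClassSumTrace` (`R³ = 333R`, `333` non-square).
* permutation tools (no group theory, no quotients): `perm_pow_apply_mod` (`σ^p = 1 ⇒ σ^k x = σ^(k mod p) x`),
  `perm_fixed_of_pow_fixed` (`σ^d y = y`, `0 < d < p`, `p` prime ⇒ `σ y = y`, Bézout), `perm_fixed_of_pow_eq_pow`,
  `orbP_subset_of_mem` / **`mem_orbP_iff`** (the orbit `{σ^k x : k < p}` as a finset; membership = same orbit),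
  **`orbP_injOn`** (a non-fixed point has `p` distinct images), `sum_Ico_reflect_odd` (pairing `k ↔ p − k`);
* **`primeOrder_fixedPoints`** — `A` the adjacency matrix of an `srg(333,166,82,83)` (hypotheses of
  `ConferenceGraph333`), `p` prime with `p ≡ 3 (mod 4)`, `σ` a permutation with `σ^p = 1` preserving adjacency,
  `f` its number of fixed points: **`∃ m, f + 2·p·m = 333`**, i.e. the number of `p`-orbits is even and
  `f ≡ 333 (mod 2p)` (`p = 3`: `f ≡ 3 (6)`; `7`: `f ≡ 11 (14)`; `11`: `f ≡ 3 (22)`; `19`: `f ≡ 29 (38)`; `23`: `f ≡ 11 (46)`;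
  …).  Proof: the orbits form an equitable partition; class sums `R`; `Σ_i R_{ii} = 0`; a fixed point gives `0`, a
  `p`-orbit gives `R_{ii} = Σ_{k=1}^{p−1} S_{x,σ^k x} = 2u_i` with `u_i = Σ_{k=1}^{(p−1)/2} S_{x,σ^k x}` (pairing by
  `σ^k`-invariance and symmetry), a sum of `(p−1)/2` — odd — signs, so `u_i ≡ 1 (mod 2)`; `Σ u_i = 0` ⇒ evenly many
  `p`-orbits ⇒ `333 = f + p·(2m)`.
* **`no_fpf_primeOrder_srg333`** — no fixed-point-free automorphism of prime order `p ≡ 3 (mod 4)` (`333` odd).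
For `p ≡ 1 (mod 4)` the trace condition gives nothing at this level (`u_i` has an even number of terms; for `p = 37`
fixed-point-free orbit matrices EXIST, gen 27 `C334Orbit37Matrix`).  Ours (instance + kernel proof); the graph,
`C(334)` and `H(668)` untouched.  No `sorry`, no new definitions.
-/

namespace Summit.Ventures.DiscreteObjects.Hadamard

open Finset

/-- `333` is not a square (private copy; the public lemma lives in `ConferenceGraph333Order3`). -/
private theorem not_isSquare_333'' : ¬ IsSquare (333 : ℕ) := by
  rintro ⟨r, hr⟩
  have : r ≤ 19 := by nlinarith
  interval_cases r <;> omega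

section primeOrder
variable {V : Type*} [Fintype V] [DecidableEq V]

omit [Fintype V] [DecidableEq V] in
/-- Powers of a permutation with `σ^p = 1` reduce modulo `p`. -/
theorem perm_pow_apply_mod (σ : Equiv.Perm V) {p : ℕ} (hσ : σ ^ p = 1) (k : ℕ) (x : V) :
    (σ ^ k) x = (σ ^ (k % p)) x := by
  rw [pow_eq_pow_mod k hσ]

omit [Fintype V] [DecidableEq V] in
/-- If `σ^p = 1` with `p` prime and `σ^d` fixes `y` for some `0 < d < p`, then `σ` fixes `y`. -/
theorem perm_fixed_of_pow_fixed (σ : Equiv.Perm V) {p d : ℕ} (hp : p.Prime) (hσ : σ ^ p = 1) (hd0 : 0 < d)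
    (hdp : d < p) (y : V) (hy : (σ ^ d) y = y) : σ y = y := by
  have hcop : Nat.Coprime d p :=
    Nat.Coprime.symm ((Nat.Prime.coprime_iff_not_dvd hp).mpr fun h => absurd (Nat.le_of_dvd hd0 h) (by omega))
  obtain ⟨m, -, hm⟩ := Nat.exists_mul_mod_eq_one_of_coprime hcop hp.one_lt
  have hfix : ∀ j : ℕ, (σ ^ (d * j)) y = y := by
    intro j
    induction j with
    | zero => simp
    | succ j ih => rw [Nat.mul_succ, pow_add, Equiv.Perm.mul_apply, hy, ih]
  calc σ y = (σ ^ 1) y := by simp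
    _ = (σ ^ ((d * m) % p)) y := by rw [hm]
    _ = (σ ^ (d * m)) y := by rw [← perm_pow_apply_mod σ hσ]
    _ = y := hfix m

omit [Fintype V] [DecidableEq V] in
/-- `σ` commutes with its powers on points. -/
theorem perm_pow_apply_comm (σ : Equiv.Perm V) (k : ℕ) (x : V) : (σ ^ k) (σ x) = σ ((σ ^ k) x) := by
  rw [← Equiv.Perm.mul_apply, ← Equiv.Perm.mul_apply, ← pow_succ, ← pow_succ']

omit [Fintype V] [DecidableEq V] in
/-- Two powers `σ^k x = σ^l x` with `l < k < p` (`p` prime, `σ^p = 1`) force `σ x = x`. -/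
theorem perm_fixed_of_pow_eq_pow (σ : Equiv.Perm V) {p : ℕ} (hp : p.Prime) (hσ : σ ^ p = 1) (x : V) {k l : ℕ}
    (hk : k < p) (hlk : l < k) (h : (σ ^ k) x = (σ ^ l) x) : σ x = x := by
  -- y = σ^l x is fixed by σ^(k-l), hence by σ
  have hy : (σ ^ (k - l)) ((σ ^ l) x) = (σ ^ l) x := by
    rw [← Equiv.Perm.mul_apply, ← pow_add, Nat.sub_add_cancel hlk.le, h]
  have hσy : σ ((σ ^ l) x) = (σ ^ l) x := perm_fixed_of_pow_fixed σ hp hσ (by omega) (by omega) _ hy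
  -- transport back to x via σ^(p-l)
  have hx : (σ ^ (p - l)) ((σ ^ l) x) = x := by
    rw [← Equiv.Perm.mul_apply, ← pow_add, Nat.sub_add_cancel (by omega : l ≤ p), hσ, Equiv.Perm.one_apply]
  calc σ x = σ ((σ ^ (p - l)) ((σ ^ l) x)) := by rw [hx]
    _ = (σ ^ (p - l)) (σ ((σ ^ l) x)) := by rw [perm_pow_apply_comm]
    _ = x := by rw [hσy, hx]

omit [Fintype V] in
/-- If `y` lies in the orbit finset `{σ^k x : k < p}` (`σ^p = 1`, `0 < p`) then its orbit finset is contained in it. -/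
theorem orbP_subset_of_mem (σ : Equiv.Perm V) {p : ℕ} (hp : 0 < p) (hσ : σ ^ p = 1) (x y : V)
    (hy : y ∈ (Finset.range p).image (fun k => (σ ^ k) x)) :
    (Finset.range p).image (fun k => (σ ^ k) y) ⊆ (Finset.range p).image (fun k => (σ ^ k) x) := by
  obtain ⟨k, -, rfl⟩ := Finset.mem_image.mp hy
  intro z hz
  obtain ⟨l, -, rfl⟩ := Finset.mem_image.mp hz
  refine Finset.mem_image.mpr ⟨(l + k) % p, Finset.mem_range.mpr (Nat.mod_lt _ hp), ?_⟩
  show (σ ^ ((l + k) % p)) x = (σ ^ l) ((σ ^ k) x)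
  rw [← perm_pow_apply_mod σ hσ, pow_add, Equiv.Perm.mul_apply]

omit [Fintype V] in
/-- The orbit `{σ^k x : k < p}` as a finset: membership is 'same orbit' (`σ^p = 1`, `0 < p`). -/
theorem mem_orbP_iff (σ : Equiv.Perm V) {p : ℕ} (hp : 0 < p) (hσ : σ ^ p = 1) (x y : V) :
    y ∈ (Finset.range p).image (fun k => (σ ^ k) x) ↔
      (Finset.range p).image (fun k => (σ ^ k) y) = (Finset.range p).image (fun k => (σ ^ k) x) := by
  constructor
  · intro hy
    refine Finset.Subset.antisymm (orbP_subset_of_mem σ hp hσ x y hy) (orbP_subset_of_mem σ hp hσ y x ?_)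
    obtain ⟨k, hk, rfl⟩ := Finset.mem_image.mp hy
    rw [Finset.mem_range] at hk
    refine Finset.mem_image.mpr ⟨(p - k) % p, Finset.mem_range.mpr (Nat.mod_lt _ hp), ?_⟩
    show (σ ^ ((p - k) % p)) ((σ ^ k) x) = x
    rw [← perm_pow_apply_mod σ hσ, ← Equiv.Perm.mul_apply, ← pow_add, Nat.sub_add_cancel hk.le, hσ,
      Equiv.Perm.one_apply]
  · intro h
    rw [← h]
    exact Finset.mem_image.mpr ⟨0, Finset.mem_range.mpr hp, by simp⟩

omit [Fintype V] [DecidableEq V] in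
/-- The orbit of a NON-fixed point of a permutation of prime order has exactly `p` elements (injectivity). -/
theorem orbP_injOn (σ : Equiv.Perm V) {p : ℕ} (hp : p.Prime) (hσ : σ ^ p = 1) (x : V) (hx : σ x ≠ x) :
    Set.InjOn (fun k => (σ ^ k) x) (Finset.range p : Set ℕ) := by
  intro k hk l hl hkl
  simp only [Finset.coe_range, Set.mem_Iio] at hk hl
  by_contra hne
  rcases Nat.lt_or_gt_of_ne hne with h | h
  · exact hx (perm_fixed_of_pow_eq_pow σ hp hσ x hl h hkl.symm)
  · exact hx (perm_fixed_of_pow_eq_pow σ hp hσ x hk h hkl)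

/-- Reflection of a sum over `Ico h p` onto `Ico 1 h` when `h + h = p + 1`. -/
theorem sum_Ico_reflect_odd (f : ℕ → ℤ) {p h : ℕ} (hh : h + h = p + 1) (hsym : ∀ k, 0 < k → k < p → f (p - k) = f k) :
    ∑ k ∈ Finset.Ico h p, f k = ∑ k ∈ Finset.Ico 1 h, f k := by
  have himg : (Finset.Ico 1 h).image (fun k => p - k) = Finset.Ico h p := by
    ext j
    simp only [Finset.mem_image, Finset.mem_Ico]
    constructor
    · rintro ⟨k, hk, rfl⟩; omega
    · intro hj; exact ⟨p - j, by omega, by omega⟩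
  rw [← himg, Finset.sum_image (fun k hk l hl (hkl : p - k = p - l) => by
    simp only [Finset.coe_Ico, Set.mem_Ico] at hk hl; omega)]
  exact Finset.sum_congr rfl fun k hk => by
    rw [Finset.mem_Ico] at hk
    exact hsym k hk.1 (by omega)

/-- **Prime-order automorphisms of `srg(333,166,82,83)`, `p ≡ 3 (mod 4)`.**  If `σ` is a permutation of the vertices
with `σ^p = 1` (`p` prime, `p ≡ 3 (mod 4)`) preserving adjacency, then the number `f` of fixed points satisfies
`f + 2·p·m = 333` for some `m`, i.e. `f ≡ 333 (mod 2p)`: the number of `p`-orbits is EVEN.  Proof: orbit partition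
(orbits as finsets `{σ^k x : k < p}`) ⇒ class sums `R`; `Σ_i R_{ii} = 0` (`ClassSumTrace`); a fixed point gives
`R_{ii} = 0`, a `p`-orbit gives `R_{ii} = Σ_{k=1}^{p−1} S_{x,σ^k x} = 2·Σ_{k=1}^{(p−1)/2} S_{x,σ^k x}` (pairing
`k ↔ p − k` by invariance and symmetry), an EVEN number `2u_i` with `u_i` a sum of `(p−1)/2` — an ODD number of —
signs, so `u_i` is odd; `Σ u_i = 0` forces an even number of `p`-orbits. -/
theorem primeOrder_fixedPoints (hV : Fintype.card V = 333) (A : Matrix V V ℤ)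
    (h01 : ∀ x y, A x y = 0 ∨ A x y = 1) (hsymm : ∀ x y, A y x = A x y) (hdiag : ∀ x, A x x = 0)
    (hk : ∀ x, ∑ y, A x y = 166) (hsrg : ∀ x y, ∑ z, A x z * A z y = 83 * (1 + (if x = y then 1 else 0)) - A x y)
    {p : ℕ} (hp : p.Prime) (hp4 : p % 4 = 3) (σ : Equiv.Perm V) (hσ : σ ^ p = 1)
    (hA : ∀ x y, A (σ x) (σ y) = A x y) :
    ∃ m : ℕ, (univ.filter fun x => σ x = x).card + 2 * p * m = 333 := by
  classical
  have hp0 : 0 < p := hp.pos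
  obtain ⟨hSd, hSo, hSs, hS1, hSS⟩ := seidel_identities_of_conferenceGraph A h01 hsymm hdiag 83
    (by rw [hV]; norm_num) (fun x => by rw [hk x]; norm_num) hsrg
  set S : V → V → ℤ := fun x y => 1 - (if x = y then 1 else 0) - 2 * A x y with hS_def
  have hSS' : ∀ x y, ∑ z, S x z * S z y = 333 * (if x = y then 1 else 0) - 1 := fun x y => by
    rw [hSS x y, hV]; norm_num
  have hSσ : ∀ x y, S (σ x) (σ y) = S x y := fun x y => by
    simp only [hS_def, hA, σ.injective.eq_iff]
  have hSσk : ∀ (k : ℕ) x y, S ((σ ^ k) x) ((σ ^ k) y) = S x y := by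
    intro k; induction k with
    | zero => intro x y; simp
    | succ k ih => intro x y; rw [pow_succ', Equiv.Perm.mul_apply, Equiv.Perm.mul_apply, hSσ, ih]
  have hSd' : ∀ x, S x x = 0 := fun x => hSd x
  have hSo' : ∀ x y, x ≠ y → S x y = 1 ∨ S x y = -1 := fun x y => hSo x y
  have hSs' : ∀ x y, S y x = S x y := fun x y => hSs x y
  -- orbits as finsets
  set orb : V → Finset V := fun x => (Finset.range p).image (fun k => (σ ^ k) x) with horb_def
  have horb_mem : ∀ x y, y ∈ orb x ↔ orb y = orb x := fun x y => mem_orbP_iff σ hp0 hσ x y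
  have horb_σ : ∀ y, orb (σ y) = orb y := fun y => (horb_mem y (σ y)).mp (by
    simp only [horb_def]
    rcases Nat.lt_or_ge 1 p with h1 | h1
    · exact Finset.mem_image.mpr ⟨1, Finset.mem_range.mpr h1, by simp⟩
    · have hp1 : p = 1 := by omega
      exact Finset.mem_image.mpr ⟨0, Finset.mem_range.mpr hp0, by
        have : σ = 1 := by rw [← pow_one σ, ← hp1, hσ]
        simp [this]⟩)
  set ι := {j : Finset V // j ∈ univ.image orb} with hι_def
  set cls : V → ι := fun x => ⟨orb x, Finset.mem_image_of_mem _ (Finset.mem_univ x)⟩ with hcls_def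
  have hcls_eq : ∀ x y, cls y = cls x ↔ orb y = orb x := fun x y => by
    rw [hcls_def, Subtype.mk.injEq]
  have hcls_σ : ∀ y, cls (σ y) = cls y := fun y => (hcls_eq y (σ y)).mpr (horb_σ y)
  have hcell : ∀ x, (univ.filter fun y => cls y = cls x) = orb x := by
    intro x; ext y
    rw [Finset.mem_filter, hcls_eq, ← horb_mem]
    simp
  have hrep : ∀ i : ι, ∃ x, cls x = i := by
    rintro ⟨j, hj⟩
    obtain ⟨x, -, hx⟩ := Finset.mem_image.mp hj
    exact ⟨x, Subtype.ext hx⟩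
  choose rep hrep using hrep
  set R : Matrix ι ι ℤ := fun i j => ∑ y ∈ univ.filter (fun y => cls y = j), S (rep i) y with hR_def
  have hshift : ∀ r (j : ι), ∑ y ∈ univ.filter (fun y => cls y = j), S (σ r) y =
      ∑ y ∈ univ.filter (fun y => cls y = j), S r y := by
    intro r j
    rw [Finset.sum_filter, Finset.sum_filter]
    exact Fintype.sum_equiv σ.symm _ _ fun y => by
      rw [show cls y = cls (σ (σ.symm y)) by rw [Equiv.apply_symm_apply], hcls_σ,
        show S (σ r) y = S (σ r) (σ (σ.symm y)) by rw [Equiv.apply_symm_apply], hSσ]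
  have hshiftk : ∀ (k : ℕ) r (j : ι), ∑ y ∈ univ.filter (fun y => cls y = j), S ((σ ^ k) r) y =
      ∑ y ∈ univ.filter (fun y => cls y = j), S r y := by
    intro k; induction k with
    | zero => intro r j; simp
    | succ k ih => intro r j; rw [pow_succ', Equiv.Perm.mul_apply, hshift, ih]
  have hR : ∀ x j, ∑ y ∈ univ.filter (fun y => cls y = j), S x y = R (cls x) j := by
    intro x j
    have hx : x ∈ orb (rep (cls x)) := by rw [horb_mem, ← hcls_eq, hrep]
    obtain ⟨k, -, hkx⟩ := Finset.mem_image.mp hx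
    rw [hR_def]; simp only
    conv_lhs => rw [← hkx]
    exact hshiftk k _ j
  have hids := fun i k => seidel333_classSum_identities S hSs hS1 hSS' cls R hR i k (rep i) (hrep i)
  have htr : ∑ i, R i i = 0 := by
    refine classSum_trace_zero R 333 not_isSquare_333'' (fun k => ((univ.filter fun y => cls y = k).card : ℤ))
      (fun i => (hids i i).1) fun i k => ?_
    rw [(hids i k).2.1]
    push_cast
    ring
  -- half-sums over the orbit
  set h := (p + 1) / 2 with hh_def
  have hh : h + h = p + 1 := by omega
  set u : ι → ℤ := fun i => ∑ k ∈ Finset.Ico 1 h, S (rep i) ((σ ^ k) (rep i)) with hu_def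
  have hdiagR : ∀ i, R i i = if σ (rep i) = rep i then 0 else 2 * u i := by
    intro i
    have h0 : R i i = ∑ y ∈ orb (rep i), S (rep i) y := by
      rw [hR_def]; simp only; rw [← hcell (rep i), hrep]
    rw [h0]
    split_ifs with hfix
    · have : orb (rep i) = {rep i} := by
        rw [horb_def]; ext y
        simp only [Finset.mem_image, Finset.mem_range, Finset.mem_singleton]
        constructor
        · rintro ⟨k, -, rfl⟩; exact Equiv.Perm.pow_apply_eq_self_of_apply_eq_self hfix k
        · rintro rfl; exact ⟨0, hp0, by simp⟩
      rw [this, Finset.sum_singleton, hSd']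
    · simp only [horb_def]
      rw [Finset.sum_image (orbP_injOn σ hp hσ (rep i) hfix), Finset.range_eq_Ico,
        ← Finset.sum_Ico_consecutive _ (by omega : 0 ≤ 1) (by omega : 1 ≤ p), Finset.sum_Ico_succ_top (by rfl),
        Finset.Ico_self, Finset.sum_empty, zero_add, pow_zero, Equiv.Perm.one_apply, hSd', zero_add,
        ← Finset.sum_Ico_consecutive _ (by omega : 1 ≤ h) (by omega : h ≤ p),
        sum_Ico_reflect_odd (fun k => S (rep i) ((σ ^ k) (rep i))) hh (fun k hk0 hkp => ?_), hu_def]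
      · ring
      · -- symmetry S r (σ^(p-k) r) = S r (σ^k r)
        show S (rep i) ((σ ^ (p - k)) (rep i)) = S (rep i) ((σ ^ k) (rep i))
        rw [← hSσk k (rep i) ((σ ^ (p - k)) (rep i)), ← Equiv.Perm.mul_apply, ← pow_add,
          Nat.add_sub_cancel' hkp.le, hσ, Equiv.Perm.one_apply, hSs']
  -- u i is odd for every p-orbit: a sum of (p-1)/2 signs
  have hu_odd : ∀ i, σ (rep i) ≠ rep i → ((u i : ℤ) : ZMod 2) = 1 := by
    intro i hfix
    rw [hu_def]; simp only
    rw [Int.cast_sum]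
    have hterm : ∀ k ∈ Finset.Ico 1 h, ((S (rep i) ((σ ^ k) (rep i)) : ℤ) : ZMod 2) = 1 := by
      intro k hk
      rw [Finset.mem_Ico] at hk
      have hne : rep i ≠ (σ ^ k) (rep i) := by
        intro e
        have := orbP_injOn σ hp hσ (rep i) hfix (show k ∈ (Finset.range p : Set ℕ) by simp; omega)
          (show 0 ∈ (Finset.range p : Set ℕ) by simp; omega) (by simp [← e])
        omega
      rcases hSo' _ _ hne with e | e <;> rw [e] <;> decide
    rw [Finset.sum_congr rfl hterm, Finset.sum_const, Nat.card_Ico, nsmul_eq_mul, mul_one]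
    have : h - 1 = 2 * ((h - 1) / 2) + 1 := by omega
    rw [this]; push_cast
    rw [show (2 : ZMod 2) = 0 from rfl]; ring
  -- the set T of p-orbits has even size
  set T := (univ : Finset ι).filter (fun i => σ (rep i) ≠ rep i) with hT_def
  have hTeven : 2 ∣ T.card := by
    have hsumT : ∑ i ∈ T, u i = 0 := by
      have e := htr
      rw [Finset.sum_congr rfl fun i _ => hdiagR i, Finset.sum_ite, Finset.sum_const_zero, zero_add,
        ← Finset.mul_sum] at e
      have e' : ∑ i ∈ univ.filter (fun i => ¬ σ (rep i) = rep i), u i = 0 := by linarith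
      rw [hT_def]; convert e' using 2
    have hcast : ((∑ i ∈ T, u i : ℤ) : ZMod 2) = (T.card : ZMod 2) := by
      rw [Int.cast_sum, Finset.card_eq_sum_ones, Nat.cast_sum]
      refine Finset.sum_congr rfl fun i hi => ?_
      rw [Nat.cast_one]
      exact hu_odd i (fun e => (Finset.mem_filter.mp hi).2 e)
    rw [hsumT, Int.cast_zero] at hcast
    exact (ZMod.natCast_eq_zero_iff _ 2).mp hcast.symm
  -- counting
  have horb_card : ∀ i, (orb (rep i)).card = if σ (rep i) = rep i then 1 else p := by
    intro i
    split_ifs with hfix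
    · have : orb (rep i) = {rep i} := by
        rw [horb_def]; ext y
        simp only [Finset.mem_image, Finset.mem_range, Finset.mem_singleton]
        constructor
        · rintro ⟨k, -, rfl⟩; exact Equiv.Perm.pow_apply_eq_self_of_apply_eq_self hfix k
        · rintro rfl; exact ⟨0, hp0, by simp⟩
      rw [this, Finset.card_singleton]
    · simp only [horb_def]
      rw [Finset.card_image_of_injOn (orbP_injOn σ hp hσ (rep i) hfix), Finset.card_range]
  have horb_fixed : ∀ i, ((orb (rep i)).filter fun y => σ y = y).card = if σ (rep i) = rep i then 1 else 0 := by
    intro i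
    split_ifs with hfix
    · have : orb (rep i) = {rep i} := by
        rw [horb_def]; ext y
        simp only [Finset.mem_image, Finset.mem_range, Finset.mem_singleton]
        constructor
        · rintro ⟨k, -, rfl⟩; exact Equiv.Perm.pow_apply_eq_self_of_apply_eq_self hfix k
        · rintro rfl; exact ⟨0, hp0, by simp⟩
      rw [this, Finset.filter_singleton, if_pos hfix, Finset.card_singleton]
    · rw [Finset.card_eq_zero, Finset.filter_eq_empty_iff]
      intro y hy
      rw [horb_def] at hy
      obtain ⟨k, -, rfl⟩ := Finset.mem_image.mp hy
      intro e
      rw [← perm_pow_apply_comm] at e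
      exact hfix ((σ ^ k).injective e)
  have h333 : (333 : ℕ) = ∑ i : ι, (orb (rep i)).card := by
    rw [← hV, ← Finset.card_univ, Finset.card_eq_sum_card_fiberwise (f := cls) (t := univ)
      fun _ _ => Finset.mem_univ _]
    exact Finset.sum_congr rfl fun i _ => by rw [← hrep i, hcell, hrep]
  have hf : (univ.filter fun x => σ x = x).card = ∑ i : ι, ((orb (rep i)).filter fun y => σ y = y).card := by
    rw [Finset.card_eq_sum_card_fiberwise (f := cls) (s := univ.filter fun x => σ x = x) (t := univ)
      fun _ _ => Finset.mem_univ _]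
    refine Finset.sum_congr rfl fun i _ => congrArg Finset.card ?_
    ext y
    rw [Finset.mem_filter, Finset.mem_filter, Finset.mem_filter, ← hcell (rep i), Finset.mem_filter, hrep]
    tauto
  rw [Finset.sum_congr rfl fun i _ => horb_card i, Finset.sum_ite, Finset.sum_const, Finset.sum_const] at h333
  rw [Finset.sum_congr rfl fun i _ => horb_fixed i, Finset.sum_ite, Finset.sum_const, Finset.sum_const] at hf
  simp only [smul_eq_mul, mul_one, mul_zero, add_zero] at h333 hf
  have hTc : (univ.filter fun i : ι => ¬ σ (rep i) = rep i).card = T.card := by rw [hT_def]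
  rw [hTc] at h333
  obtain ⟨m, hm⟩ := hTeven
  refine ⟨m, ?_⟩
  rw [hf, h333, hm]
  ring

/-- **No fixed-point-free automorphism of prime order `p ≡ 3 (mod 4)`** of an `srg(333,166,82,83)`
(`333` is odd, so `f + 2pm = 333` excludes `f = 0`). -/
theorem no_fpf_primeOrder_srg333 (hV : Fintype.card V = 333) (A : Matrix V V ℤ)
    (h01 : ∀ x y, A x y = 0 ∨ A x y = 1) (hsymm : ∀ x y, A y x = A x y) (hdiag : ∀ x, A x x = 0)
    (hk : ∀ x, ∑ y, A x y = 166) (hsrg : ∀ x y, ∑ z, A x z * A z y = 83 * (1 + (if x = y then 1 else 0)) - A x y)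
    {p : ℕ} (hp : p.Prime) (hp4 : p % 4 = 3) (σ : Equiv.Perm V) (hσ : σ ^ p = 1)
    (hA : ∀ x y, A (σ x) (σ y) = A x y) (hfpf : ∀ x, σ x ≠ x) : False := by
  obtain ⟨m, hm⟩ := primeOrder_fixedPoints hV A h01 hsymm hdiag hk hsrg hp hp4 σ hσ hA
  rw [Finset.filter_eq_empty_iff.mpr (fun x _ => hfpf x), Finset.card_empty, zero_add] at hm
  have h2 : 2 ∣ 333 := ⟨p * m, by rw [← hm]; ring⟩
  exact absurd h2 (by decide)

end primeOrder

end Summit.Ventures.DiscreteObjects.Hadamard
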